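import Literature.NumberTheory.LFunctions.WeilExplicitDirichlet
import Literature.NumberTheory.LFunctions.RiemannSiegelFacts
import Mathlib.NumberTheory.MulChar.Lemmas
import HarnessLib

/-!
# Conjugate characters share their Weil rungs: `Q_{χ̄}(g) = conj Q_χ(ḡ)`

Extension of `WeilExplicitDirichlet.lean` (Weil 1952 with characters, `k = ℚ`). For a Dirichlet
character `χ` mod `q` and ANY `k : ℝ → ℂ`, writing `k̄(t) := conj (k t)`:
`weilFunctionalChar χ⁻¹ k = conj (weilFunctionalChar χ k̄)` — term by term: `χ⁻¹(n) = conj χ(n)`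
(Mathlib `MulChar.star_apply'`); `(k̄)^(s) = conj k̂(conj s)` (`weilMellin_conj`), so on the critical
line `(k̄)^(1/2 + it) = conj k̂(1/2 - it)`, and `Re ψ(1/4 + a/2 + it/2)` is even in `t`
(`digamma_conj`); `charParity χ⁻¹ = charParity χ`; the polar term (modulus `1`) likewise.  Since
`ḡ ⋆ (ḡ)̃ = conj ∘ (g ⋆ g̃)` pointwise, `weilQuadraticChar χ⁻¹ g = conj (weilQuadraticChar χ ḡ)`:
the rung predicates of `χ` and `χ̄ = χ⁻¹` COINCIDE,
`WeilPositivityOnChar χ⁻¹ a ↔ WeilPositivityOnChar χ a` (and `WeilPositivityChar`).  This is the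
test-function side of Weil's remark that the zeros of `L(s, χ̄)` are the complex conjugates of
those of `L(s, χ)` (functional equation (6), `Λ(1 - s̄) = ϰ conj Λ(s)`), and it is why the cell's
archive `EXTREMALS/GRH/` keys one rung directory per PAIR `{χ, χ̄}` (79 primitive characters of
conductor `≤ 20` ↦ 46 columns per window).  Everything is hypothesis-free in `k`/`g` (Bochner
integrals and `tsum` commute with `conj` unconditionally; both sides are junk together).

Reference: A. Weil, *Sur les «formules explicites» de la théorie des nombres premiers* (1952),
eq. (6) p. 254 and (11) p. 262 (the `χ(𝔭)^{-n}` term). [Weil1952FormulesExplicites]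
-/

noncomputable section

open Complex Filter Set MeasureTheory
open scoped Real Topology ComplexConjugate

namespace Literature.NumberTheory.LFunctions

variable {q : ℕ} (χ : DirichletCharacter ℂ q) (k g : ℝ → ℂ)

/-- `χ⁻¹ = χ̄` has the same parity as `χ` (`χ⁻¹(-1) = conj χ(-1) = χ(-1)` as `χ(-1) = ±1`).
[cite: Weil1952FormulesExplicites, (1) p. 253 (f_ρ ∈ {0,1})] -/
theorem charParity_inv [NeZero q] : charParity χ⁻¹ = charParity χ := by
  rcases χ.even_or_odd with h | h
  · have h' : χ⁻¹.Even := by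
      rw [DirichletCharacter.Even, ← MulChar.star_apply', h, star_one]
    rw [charParity_of_even h, charParity_of_even h']
  · have h' : χ⁻¹.Odd := by
      rw [DirichletCharacter.Odd, ← MulChar.star_apply', h, star_neg, star_one]
    rw [charParity_of_odd h, charParity_of_odd h']

/-- Transform of the pointwise conjugate: `(k̄)^(s) = conj k̂(conj s)` (no hypotheses).
[cite: Weil1952FormulesExplicites, p. 257 (definition of Φ)] -/
theorem weilMellin_conj (s : ℂ) :
    weilMellin (fun x ↦ conj (k x)) s = conj (weilMellin k (conj s)) := by
  rw [weilMellin, weilMellin, ← integral_conj]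
  refine integral_congr_ae (Eventually.of_forall fun x ↦ ?_)
  simp only [map_mul, ← Complex.exp_conj, map_sub, map_mul, map_div₀, map_one, map_ofNat,
    Complex.conj_ofReal, Complex.conj_conj]

/-- On the critical line: `(k̄)^(1/2 + it) = conj k̂(1/2 - it)`. [cite: Weil1952FormulesExplicites, p. 257 (Φ(1/2+it) as a Fourier transform)] -/
theorem weilMellin_conj_half_add (t : ℝ) :
    weilMellin (fun x ↦ conj (k x)) (1 / 2 + t * I) = conj (weilMellin k (1 / 2 - t * I)) := by
  rw [weilMellin_conj]
  congr 2
  simp only [map_add, map_div₀, map_one, map_ofNat, map_mul, Complex.conj_ofReal, Complex.conj_I,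
    mul_neg, sub_eq_add_neg]

/-- The polar term of `k̄` is the conjugate of that of `k` (`conj 0 = 0`, `conj 1 = 1`). [cite: Weil1952FormulesExplicites, (8) p. 257 (δ_χ[Φ(0) + Φ(1)])] -/
theorem weilPolarTerm_conj : weilPolarTerm (fun x ↦ conj (k x)) = conj (weilPolarTerm k) := by
  rw [weilPolarTerm, weilPolarTerm, weilMellin_conj, weilMellin_conj, map_zero, map_one, map_add]

/-- The prime term of `χ⁻¹ = χ̄` at `k` is the conjugate of the prime term of `χ` at `k̄`
(`χ(𝔭)^{-n} = conj χ(𝔭)^n`). [cite: Weil1952FormulesExplicites, (11) p. 262 (the χ(𝔭)^{-n} term)] -/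
theorem weilPrimeTermChar_inv [NeZero q] :
    weilPrimeTermChar χ⁻¹ k = conj (weilPrimeTermChar χ fun x ↦ conj (k x)) := by
  rw [weilPrimeTermChar, weilPrimeTermChar, Complex.conj_tsum]
  refine tsum_congr fun n ↦ ?_
  rw [← MulChar.star_apply']
  simp only [map_mul, map_add, map_div₀, Complex.conj_ofReal, Complex.conj_conj,
    Complex.star_def]

/-- The archimedean integral of parity `a` at `k̄` is the conjugate of the one at `k`: substitute
`t ↦ -t` and use `Re ψ(conj z) = Re ψ(z)` (`digamma_conj`). [cite: Weil1952FormulesExplicites, (10) p. 258 (J_λ, real kernel)] -/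
theorem weilArchIntegralChar_conj (a : ℕ) :
    weilArchIntegralChar a (fun x ↦ conj (k x)) = conj (weilArchIntegralChar a k) := by
  rw [weilArchIntegralChar, weilArchIntegralChar, ← integral_conj,
    ← integral_neg_eq_self (fun t : ℝ ↦ weilMellin (fun x ↦ conj (k x)) (1 / 2 + t * I) *
      ((Complex.digamma (1 / 4 + (a : ℂ) / 2 + t / 2 * I)).re : ℂ)) volume]
  refine integral_congr_ae (Eventually.of_forall fun t ↦ ?_)
  dsimp only
  have h1 : weilMellin (fun x ↦ conj (k x)) (1 / 2 + ((-t : ℝ) : ℂ) * I) =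
      conj (weilMellin k (1 / 2 + (t : ℂ) * I)) := by
    rw [weilMellin_conj_half_add, Complex.ofReal_neg, neg_mul, sub_neg_eq_add]
  have h2 : (1 / 4 + (a : ℂ) / 2 + ((-t : ℝ) : ℂ) / 2 * I) =
      conj (1 / 4 + (a : ℂ) / 2 + (t : ℂ) / 2 * I) := by
    simp only [map_add, map_div₀, map_mul, Complex.conj_ofReal, Complex.conj_I, map_one, map_ofNat,
      Complex.conj_natCast, Complex.ofReal_neg]
    ring
  rw [h1, h2, digamma_conj, Complex.conj_re, map_mul, Complex.conj_ofReal]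

/-- The archimedean term (conductor `q`, parity `a`) at `k̄` is the conjugate of the one at `k`.
[cite: Weil1952FormulesExplicites, (11) p. 262, k = ℚ (archimedean term)] -/
theorem weilArchTermChar_conj (q a : ℕ) :
    weilArchTermChar q a (fun x ↦ conj (k x)) = conj (weilArchTermChar q a k) := by
  rw [weilArchTermChar, weilArchTermChar, weilArchIntegralChar_conj]
  simp only [map_add, map_mul, Complex.conj_ofReal, map_div₀, map_one, map_ofNat]

/-- **`W_{χ̄}(k) = conj W_χ(k̄)`** for every `k : ℝ → ℂ` (`χ̄ = χ⁻¹`). [cite: Weil1952FormulesExplicites, (6) p. 254 and (11) p. 262] -/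
theorem weilFunctionalChar_inv [NeZero q] :
    weilFunctionalChar χ⁻¹ k = conj (weilFunctionalChar χ fun x ↦ conj (k x)) := by
  rw [weilFunctionalChar, weilFunctionalChar, charParity_inv, weilPrimeTermChar_inv,
    map_add, map_sub, weilArchTermChar_conj, Complex.conj_conj]
  congr 2
  split_ifs
  · rw [weilPolarTerm_conj, Complex.conj_conj]
  · rw [map_zero]

/-- `ḡ ⋆ (ḡ)̃ = conj ∘ (g ⋆ g̃)` pointwise (no hypotheses: `∫ conj = conj ∫`); private pointwise
variant of the tree's `weilConv_weilReflect_conj` (`WeilResolventVectorExists.lean`, stated there via the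
reflected kernel). [folklore] -/
private theorem weilConv_conj_weilReflect_conj_apply (t : ℝ) :
    weilConv (fun x ↦ conj (g x)) (weilReflect fun x ↦ conj (g x)) t =
      conj (weilConv g (weilReflect g) t) := by
  rw [weilConv_apply, weilConv_apply, ← integral_conj]
  refine integral_congr_ae (Eventually.of_forall fun u ↦ ?_)
  simp only [weilReflect, map_mul, Complex.conj_conj]

/-- **`Q_{χ̄}(g) = conj Q_χ(ḡ)`**, `ḡ = conj ∘ g`. [cite: Weil1952FormulesExplicites, (6) p. 254 and the «lemme» p. 262] -/
theorem weilQuadraticChar_inv [NeZero q] :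
    weilQuadraticChar χ⁻¹ g = conj (weilQuadraticChar χ fun x ↦ conj (g x)) := by
  rw [weilQuadraticChar, weilQuadraticChar, weilFunctionalChar_inv]
  congr 2
  funext t
  exact (weilConv_conj_weilReflect_conj_apply g t).symm

/-- Pointwise conjugation preserves the test class `C_c^∞`. [cite: Weil1952FormulesExplicites, the «lemme» p. 262 (complex-valued F₀)] -/
theorem IsWeilTest.conj {g : ℝ → ℂ} (hg : IsWeilTest g) : IsWeilTest fun x ↦ conj (g x) :=
  ⟨Complex.conjCLE.contDiff.comp hg.1, hg.2.comp_left (g := conj) (map_zero _)⟩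

/-- Pointwise conjugation does not change the topological support. [folklore] -/
private theorem tsupport_conj (g : ℝ → ℂ) : tsupport (fun x ↦ conj (g x)) = tsupport g := by
  simp only [tsupport, Function.support]
  congr 1
  ext x
  simp

/-- **Conjugate characters share every rung**: `WeilPositivityOnChar χ⁻¹ a ↔ WeilPositivityOnChar χ a`
(apply `Q_{χ̄}(g) = conj Q_χ(ḡ)` to `g` and to `ḡ`; real parts agree). So the GRH arm certifies one
representative per pair `{χ, χ̄}`. [cite: Weil1952FormulesExplicites, (6) p. 254 (zeros of L(s, χ̄) are the conjugates)] -/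
theorem weilPositivityOnChar_inv_iff [NeZero q] (a : ℝ) :
    WeilPositivityOnChar χ⁻¹ a ↔ WeilPositivityOnChar χ a := by
  constructor
  · intro h g hg hsupp
    have h1 := h (fun x ↦ conj (g x)) hg.conj (by rwa [tsupport_conj])
    rw [weilQuadraticChar_inv, Complex.conj_re] at h1
    simpa only [Complex.conj_conj] using h1
  · intro h g hg hsupp
    rw [weilQuadraticChar_inv, Complex.conj_re]
    exact h _ hg.conj (by rwa [tsupport_conj])

/-- The same for full positivity: `WeilPositivityChar χ⁻¹ ↔ WeilPositivityChar χ`. [cite: Weil1952FormulesExplicites, (6) p. 254] -/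
theorem weilPositivityChar_inv_iff [NeZero q] : WeilPositivityChar χ⁻¹ ↔ WeilPositivityChar χ := by
  rw [weilPositivityChar_iff_forall_on, weilPositivityChar_iff_forall_on]
  exact forall_congr' fun a ↦ weilPositivityOnChar_inv_iff χ a

end Literature.NumberTheory.LFunctions

end
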